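import Mathlib.Analysis.Complex.Schwarz
import HarnessLib

/-!
# Schwarz–Pick near the boundary: small discs about a point of small height have small images

Topic: Analysis / Complex. For a holomorphic map `ψ : Ω → 𝔻` and a disc `B(w, d) ⊆ Ω`, every
point of `B(w, 0.9 d)` has `‖ψ q - ψ w‖ ≤ 18 (1 - ‖ψ w‖)` (`norm_sub_le_of_mem_ball`): the
Möbius map `M_c(v) = (v - c)/(1 - c̄ v)` (`moebius`) sends `𝔻` into itself with `c ↦ 0`, the
Schwarz lemma for `M_c ∘ ψ ∘ (w + d ·)` gives pseudo-hyperbolic distance `≤ 0.9`, and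
`|v - c| ≤ 0.9 |1 - c̄ v| ≤ 0.9 ((1 - |c|²) + |c| |v - c|)`. (The form in which
Lawler–Schramm–Werner (2004), proof of Lemma 5.4, use "Because `δ` is small compared to `ε₁`, the
Koebe distortion theorem shows that `α ∩ C(w, r/8) = ∅`".) Everything here is proved.

## References

* G. F. Lawler, O. Schramm, W. Werner, Ann. Probab. 32 (2004), proof of Lemma 5.4.
  [LawlerSchrammWerner2004]
-/

noncomputable section

open Set Metric Complex

namespace Literature.Analysis.Complex

namespace SchwarzPick

/-- The disc automorphism `M_c(v) = (v - c)/(1 - c̄ v)` sending `c` to `0`. [folklore] -/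
def moebius (c v : ℂ) : ℂ := (v - c) / (1 - (starRingEnd ℂ) c * v)

/-- `|1 - c̄ v|² - |v - c|² = (1 - |c|²)(1 - |v|²)`. [folklore] -/
theorem normSq_identity (c v : ℂ) :
    ‖1 - (starRingEnd ℂ) c * v‖ ^ 2 - ‖v - c‖ ^ 2 = (1 - ‖c‖ ^ 2) * (1 - ‖v‖ ^ 2) := by
  simp only [Complex.sq_norm, Complex.normSq_apply, sub_re, one_re, mul_re, conj_re, conj_im,
    sub_im, one_im, mul_im]
  ring

/-- The denominator does not vanish on the disc. [folklore] -/
theorem denom_ne_zero {c v : ℂ} (hc : ‖c‖ < 1) (hv : ‖v‖ < 1) : 1 - (starRingEnd ℂ) c * v ≠ 0 := by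
  intro h
  have h1 : (starRingEnd ℂ) c * v = 1 := by linear_combination -h
  have h2 : ‖(starRingEnd ℂ) c * v‖ < 1 := by
    rw [norm_mul, Complex.norm_conj]
    nlinarith [norm_nonneg c, norm_nonneg v]
  rw [h1, norm_one] at h2
  exact lt_irrefl _ h2

/-- `|v - c| ≤ |1 - c̄ v|` on the disc. [folklore] -/
theorem norm_sub_le_norm_denom {c v : ℂ} (hc : ‖c‖ < 1) (hv : ‖v‖ < 1) :
    ‖v - c‖ ≤ ‖1 - (starRingEnd ℂ) c * v‖ := by
  have h := normSq_identity c v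
  have h1 : 0 ≤ (1 - ‖c‖ ^ 2) * (1 - ‖v‖ ^ 2) :=
    mul_nonneg (by nlinarith [norm_nonneg c]) (by nlinarith [norm_nonneg v])
  exact le_of_sq_le_sq (by nlinarith) (norm_nonneg _)

/-- `M_c` maps the disc into the closed disc. [folklore] -/
theorem norm_moebius_le {c v : ℂ} (hc : ‖c‖ < 1) (hv : ‖v‖ < 1) : ‖moebius c v‖ ≤ 1 := by
  rw [moebius, norm_div, div_le_one (norm_pos_iff.2 (denom_ne_zero hc hv))]
  exact norm_sub_le_norm_denom hc hv

/-- `M_c c = 0`. [folklore] -/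
theorem moebius_self (c : ℂ) : moebius c c = 0 := by simp [moebius]

/-- `M_c` is differentiable on the disc. [folklore] -/
theorem differentiableOn_moebius {c : ℂ} (hc : ‖c‖ < 1) : DifferentiableOn ℂ (moebius c) (ball 0 1) := by
  intro v hv
  have hv' : ‖v‖ < 1 := mem_ball_zero_iff.1 hv
  apply DifferentiableAt.differentiableWithinAt
  unfold moebius
  exact ((differentiableAt_id.sub_const c).div ((differentiableAt_const _).sub
    ((differentiableAt_const _).mul differentiableAt_id)) (denom_ne_zero hc hv'))

/-- **From pseudo-hyperbolic to Euclidean near the boundary**: `‖M_c v‖ ≤ 9/10` implies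
`‖v - c‖ ≤ 18 (1 - ‖c‖)`. [folklore] -/
theorem norm_sub_le_of_norm_moebius_le {c v : ℂ} (hc : ‖c‖ < 1) (hv : ‖v‖ < 1)
    (h : ‖moebius c v‖ ≤ 9 / 10) : ‖v - c‖ ≤ 18 * (1 - ‖c‖) := by
  have hden := denom_ne_zero hc hv
  rw [moebius, norm_div, div_le_iff₀ (norm_pos_iff.2 hden)] at h
  -- `|1 - c̄ v| ≤ (1 - |c|²) + |c| |v - c|`
  have h1 : ‖1 - (starRingEnd ℂ) c * v‖ ≤ (1 - ‖c‖ ^ 2) + ‖c‖ * ‖v - c‖ := by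
    have e : 1 - (starRingEnd ℂ) c * v = (1 - (starRingEnd ℂ) c * c) + (starRingEnd ℂ) c * (c - v) := by ring
    rw [e]
    calc ‖(1 - (starRingEnd ℂ) c * c) + (starRingEnd ℂ) c * (c - v)‖
        ≤ ‖1 - (starRingEnd ℂ) c * c‖ + ‖(starRingEnd ℂ) c * (c - v)‖ := norm_add_le _ _
      _ = (1 - ‖c‖ ^ 2) + ‖c‖ * ‖v - c‖ := by
          rw [Complex.conj_mul', norm_mul, Complex.norm_conj, norm_sub_rev c v]
          congr 1
          have : (1 : ℂ) - (‖c‖ : ℂ) ^ 2 = ((1 - ‖c‖ ^ 2 : ℝ) : ℂ) := by push_cast; ring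
          rw [this, Complex.norm_real, Real.norm_eq_abs, abs_of_nonneg (by nlinarith [norm_nonneg c])]
  have hc0 := norm_nonneg c
  have h2 : ‖v - c‖ * (1 - 9 / 10 * ‖c‖) ≤ 9 / 10 * (1 - ‖c‖ ^ 2) := by nlinarith [norm_nonneg (v - c)]
  have h3 : 0 < 1 - 9 / 10 * ‖c‖ := by nlinarith
  rw [← le_div_iff₀ h3] at h2
  refine h2.trans ?_
  rw [div_le_iff₀ h3]
  nlinarith

/-- **Schwarz–Pick near the boundary.** Let `ψ` be holomorphic on the open set `Ω` with values in
the unit disc, and let `B(w, d) ⊆ Ω`. Then for `q ∈ B(w, 9d/10)`,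
`‖ψ q - ψ w‖ ≤ 18 (1 - ‖ψ w‖)`. [cite: LawlerSchrammWerner2004, proof of Lemma 5.4] -/
theorem norm_sub_le_of_mem_ball {Ω : Set ℂ} {ψ : ℂ → ℂ} (hψ : DifferentiableOn ℂ ψ Ω)
    (hψb : MapsTo ψ Ω (ball 0 1)) {w : ℂ} {d : ℝ} (hd : 0 < d) (hball : ball w d ⊆ Ω)
    {q : ℂ} (hq : q ∈ ball w (9 * d / 10)) : ‖ψ q - ψ w‖ ≤ 18 * (1 - ‖ψ w‖) := by
  set c := ψ w with hc_def
  have hwΩ : w ∈ Ω := hball (mem_ball_self hd)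
  have hc : ‖c‖ < 1 := mem_ball_zero_iff.1 (hψb hwΩ)
  have hqΩ : q ∈ ball w d := ball_subset_ball (by linarith) hq
  have hv : ‖ψ q‖ < 1 := mem_ball_zero_iff.1 (hψb (hball hqΩ))
  -- the map `f = M_c ∘ ψ` on `ball w d`
  set f : ℂ → ℂ := fun p ↦ moebius c (ψ p) with hf
  have hfd : DifferentiableOn ℂ f (ball w d) := by
    refine (differentiableOn_moebius hc).comp (hψ.mono hball) fun p hp ↦ hψb (hball hp)
  have hfw : f w = 0 := by simp [hf, hc_def, moebius_self]
  have hmaps : MapsTo f (ball w d) (closedBall (f w) 1) := fun p hp ↦ by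
    rw [hfw, mem_closedBall, dist_zero_right]
    exact norm_moebius_le hc (mem_ball_zero_iff.1 (hψb (hball hp)))
  have key := Complex.dist_le_div_mul_dist_of_mapsTo_ball hfd hmaps hqΩ
  rw [hfw, dist_zero_right] at key
  have hq' : dist q w < 9 * d / 10 := hq
  have h9 : ‖f q‖ ≤ 9 / 10 := by
    calc ‖f q‖ ≤ 1 / d * dist q w := key
      _ ≤ 1 / d * (9 * d / 10) := by gcongr
      _ = 9 / 10 := by field_simp
  exact norm_sub_le_of_norm_moebius_le hc hv h9

end SchwarzPick

end Literature.Analysis.Complex
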